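import Summits.Ventures.PercRepro.S3SixWindow
import Summits.Ventures.PercRepro.RankLevelSetLevelSplitAll
import Summits.Ventures.PercRepro.RankLevelSetLevelSixMult4
import Summits.Ventures.PercRepro.RankLevelSetLevelSixGlue
import Summits.Ventures.PercRepro.RankLevelSetCoreSixFiftyTwo

/-!
# PercRepro — S3, THE OPEN CELLS AFTER THE MULTIPLICITY CHAIN AND THE CORANK-`≥ 51` THEOREM FROM `p ≥ 52` (p8, S3)

`proofs/SUBCLAIM-S3-p8.md` §1 / §3, refreshed: the cell structure of `S3SixWindow` with the sharper tree theorems —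
`c025_core_six_bounded_corank_mult4` (coranks `7 … 50` closed from `p ≥ 255`, RankLevelSetLevelSixMult4) and
`c025_core_six_fortythree_fiftytwo` (corank `≥ 51` closed from `p ≥ 52`, RankLevelSetCoreSixFiftyTwo), and the level-`5`
row of the split chain (`c025_five_large_split`, `p ≥ 175`):
* **`rls_six_at_of_open_cells'`** — level `6` at `p₀ ≥ 9` ⇐ level `5` at `p₀ − 1` + the core cells `(p₀, 7 ≤ d ≤ 50)`
  when `p₀ < 255` + the cells `(p₀, d ≥ 51)` when `p₀ < 52`;
* **`s3Window_of_cells''`** — S3 ⇐ the `(8, 6)` cell + level `5` at `8 ≤ p ≤ 174` (the S2 window below the split row)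
  + those open cells for `9 ≤ p₀ ≤ 254`. The complement `p ≥ 256` is `c025_six_large_mult4''`;
* **`c025_six_large_two_fifty_five`** — rank `255` closes too (the per-rank wrapper on the split row and the core
  theorems): C-025 at level `6` for every `p ≥ 255`, every finite matroid.
Axioms: standard.
-/

open scoped Matroid

namespace PercRepro

namespace ThmN

variable {α : Type}

/-- **The open cells of S3 at rank `p₀`, after the multiplicity chain and the corank-`≥ 51` theorem from `52`.** -/
theorem rls_six_at_of_open_cells' (p₀ : ℕ) (hp : 9 ≤ p₀)
    (h5 : ∀ (M : Matroid α) [M.Finite], RLS M (p₀ - 1) 5)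
    (hmid : ∀ (M : Matroid α) [M.Finite] (d : ℕ), 7 ≤ d → d ≤ 50 → p₀ < 255 →
      M.eRank = (p₀ : ℕ∞) → M.E.ncard = p₀ + d → EFree M → RLS M p₀ 6)
    (hbig : ∀ (M : Matroid α) [M.Finite] (d : ℕ), 51 ≤ d → p₀ < 52 →
      M.eRank = (p₀ : ℕ∞) → M.E.ncard = p₀ + d → EFree M → RLS M p₀ 6) :
    ∀ (M : Matroid α) [M.Finite], RLS M p₀ 6 := by
  refine rls_six_at_of_core p₀ hp h5 ?_
  intro M _ d hd hR hn hfree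
  rcases Nat.lt_or_ge d 51 with hd50 | hd51
  · rcases Nat.lt_or_ge p₀ 255 with hsmall | hlarge
    · exact hmid M d hd (by omega) hsmall hR hn hfree
    · exact c025_core_six_bounded_corank_mult4 M p₀ d hlarge hd (by omega) hR hn hfree
  · rcases Nat.lt_or_ge p₀ 52 with hsmall | hlarge
    · exact hbig M d hd51 hsmall hR hn hfree
    · exact c025_core_six_fortythree_fiftytwo M p₀ hlarge hR (by omega) hfree

/-- **Rank `255` itself closes** (the per-rank wrapper): level `5` at `254` is the split row, and every core cell at rank
`255` is a tree theorem (`c025_core_six_bounded_corank_mult4` at coranks `7 … 50`, `c025_core_six_fortythree_fiftytwo`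
beyond). Hence **C-025 at level `6` for every `p ≥ 255`** — the window of record becomes `8 ≤ p ≤ 254`. -/
theorem c025_six_large_two_fifty_five (M : Matroid α) [M.Finite] (p : ℕ) (hp : 255 ≤ p) : RLS M p 6 := by
  rcases Nat.lt_or_ge p 256 with hlt | hge
  · have h255 : p = 255 := by omega
    subst h255
    refine rls_six_at_of_core 255 (by norm_num) (fun M _ => c025_five_large_split M 254 (by norm_num)) ?_ M
    intro M _ d hd hR hn hfree
    rcases Nat.lt_or_ge d 51 with hd50 | hd51
    · exact c025_core_six_bounded_corank_mult4 M 255 d (by norm_num) hd (by omega) hR hn hfree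
    · exact c025_core_six_fortythree_fiftytwo M 255 (by norm_num) hR (by omega) hfree
  · exact c025_six_large_mult4'' M p hge

end ThmN

/-- **S3 from its open cells, refreshed**: the `(8, 6)` cell, level `5` on the S2 window `8 ≤ p ≤ 174`, and the open
core cells of `rls_six_at_of_open_cells'` at every `9 ≤ p₀ ≤ 254`; `p ≥ 256` is `c025_six_large_mult4''`
(`p₀ = 255` closes from level `5` at `254` and the core theorems alone). -/
theorem s3Window_of_cells''
    (h86 : ∀ {α : Type} (M : Matroid α) [M.Finite], ThmN.RLS M 8 6)
    (h5 : ∀ {α : Type} (M : Matroid α) [M.Finite] (p : ℕ), 8 ≤ p → p ≤ 174 → ThmN.RLS M p 5)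
    (hmid : ∀ {α : Type} (M : Matroid α) [M.Finite] (p₀ d : ℕ), 9 ≤ p₀ → p₀ < 255 → 7 ≤ d → d ≤ 50 →
      M.eRank = (p₀ : ℕ∞) → M.E.ncard = p₀ + d → ThmN.EFree M → ThmN.RLS M p₀ 6)
    (hbig : ∀ {α : Type} (M : Matroid α) [M.Finite] (p₀ d : ℕ), 9 ≤ p₀ → p₀ < 52 → 51 ≤ d →
      M.eRank = (p₀ : ℕ∞) → M.E.ncard = p₀ + d → ThmN.EFree M → ThmN.RLS M p₀ 6) :
    S3Window := by
  intro α M _ p hp8 hp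
  rcases Nat.lt_or_ge p 9 with h8 | h9
  · have : p = 8 := by omega
    subst this
    exact h86 M
  · rcases Nat.lt_or_ge p 256 with hlt | hge
    · refine ThmN.rls_six_at_of_open_cells' (α := α) p h9 ?_
        (fun M _ d hd hd50 hsm hR hn hf => hmid M p d h9 hsm hd hd50 hR hn hf)
        (fun M _ d hd51 hsm hR hn hf => hbig M p d h9 hsm hd51 hR hn hf) M
      intro M _
      rcases Nat.lt_or_ge (p - 1) 175 with hlt5 | hge5
      · exact h5 M (p - 1) (by omega) (by omega)
      · exact ThmN.c025_five_large_split M (p - 1) hge5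
    · exact ThmN.c025_six_large_mult4'' M p hge

end PercRepro
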